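import Summits.QuantumAdvantage.QuantumAdvantage.Theorems.RankDialB

/-!
# RankDial (C) — part 3/4: the RUNG `EquiRankLin p` PROVED (rank `ℓ/E`) and the FRAME (`closes` BY NAME)

TARGET BY NAME (cell decomp-qadv, RESIDUAL MODE): item stmt-QuantumAdvantage-23109
`Summit.QuantumAdvantage.QuantumAdvantage.Theses.OddPrimeWalk.ManyReadersSqrtOdd` (=: T), reached through rung R5 =
`AdviceFreeQNC0.WalkHardFLinSel p` (`T → ∀ p ≥ 5, R5 p`, tree `JLinPeel`).  These files SUPPORT the item (`--supports`); they do not close it.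

§4 `equiRank_of_coprime : p.Coprime 3 → EquiRankLin p` (any modulus `p ≥ 1` coprime to 3, `[NeZero p]`): the tree's CELL LAW
`TwoModuli.abs_three_mul_card_cell_sub_card_le` (`|3·#{v ∈ cell_x : |v| ≡ b} − #cell_x| ≤ 2·(2cos(π/3p))^ℓ` for every cell
`{v : Φv = x}`) summed over the `≤ p^d` cells of a level set, with `p^d·(2cos(π/3p))^ℓ ≤ 2^ℓ/16` for `d ≤ ℓ/E`, `ℓ ≥ 4E`,
`p·cos(π/(3p))^E ≤ 1/2` (`exists_decay`, `decay_bound` [g24], `cell_law`); `equiRankLin_odd` for primes `p ≥ 5`.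
§6 the ladder on the walk-game side: `windowRankSel_holds` (arbitrary tables, `p` coprime to 3), **`windowRankLinSel_holds :
∀ p prime ≥ 5, WindowRankLinSel p`** (θ = 19/24), `windowFew_of_windowRank` / `windowFewLinSel_holds` (g24's piece recovered),
`windowHighRank_of_windowDense` (g24's residual implies the new one), the exhaustive dial `r5_of_rank_pieces : Rank → HighRank → NoWindow →
WalkHardFLinSel p`, necessity readbacks, `r5_iff_rank_pieces`, **`closes : (∀ p ≥ 5, WindowHighRankLinSel p) → (∀ p ≥ 5, NoWindowLinSel p)
→ R5LiftOdd → T`** (low-rank grade discharged inside), `closes_all`, `target_iff_pieces`, `target_iff_residual`, `r5_residual`,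
`residual_shrinks`.
-/

set_option linter.dupNamespace false
set_option autoImplicit false

noncomputable section
open Classical

namespace Summit.QuantumAdvantage.QuantumAdvantage.Theorems.RankDial

open Finset
open Summit.QuantumAdvantage.AdviceFreeQNC0

/-! ### §4 RUNG PROVED: the law at rank `ℓ/E` (sum of the tree's cell law over the cells of a level set) -/

section Rung

/-- [g24] The geometric decay constant: `∃ E ≥ 1, p · cos(π/(3p))^E ≤ ½`. -/
theorem exists_decay (p : ℕ) (hp1 : 1 ≤ p) :
    ∃ E : ℕ, 0 < E ∧ (p : ℝ) * Real.cos (Real.pi / (3 * p)) ^ E ≤ 1 / 2 := by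
  have hp : (1 : ℝ) ≤ p := by exact_mod_cast hp1
  have hpi := Real.pi_pos
  have hxpos : 0 < Real.pi / (3 * p) := by positivity
  have hxle : Real.pi / (3 * p) ≤ Real.pi / 2 := by
    apply div_le_div_of_nonneg_left hpi.le (by norm_num)
    linarith
  have hc0 : 0 ≤ Real.cos (Real.pi / (3 * p)) := by
    apply Real.cos_nonneg_of_neg_pi_div_two_le_of_le <;> linarith
  have hc1 : Real.cos (Real.pi / (3 * p)) < 1 := by
    have h := Real.cos_lt_cos_of_nonneg_of_le_pi_div_two (le_refl 0) hxle hxpos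
    rwa [Real.cos_zero] at h
  obtain ⟨n, hn⟩ := exists_pow_lt_of_lt_one (show (0 : ℝ) < 1 / (2 * p) by positivity) hc1
  refine ⟨n + 1, n.succ_pos, ?_⟩
  have hmono : Real.cos (Real.pi / (3 * p)) ^ (n + 1) ≤ Real.cos (Real.pi / (3 * p)) ^ n :=
    pow_le_pow_of_le_one hc0 hc1.le (Nat.le_succ n)
  have hp0 : (0 : ℝ) < p := by linarith
  calc (p : ℝ) * Real.cos (Real.pi / (3 * p)) ^ (n + 1)
      ≤ (p : ℝ) * Real.cos (Real.pi / (3 * p)) ^ n := mul_le_mul_of_nonneg_left hmono hp0.le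
    _ ≤ (p : ℝ) * (1 / (2 * p)) := mul_le_mul_of_nonneg_left hn.le hp0.le
    _ = 1 / 2 := by field_simp

/-- [g24] The decay estimate: `p^t c^ℓ ≤ 1/16` once `p c^E ≤ ½`, `ℓ ≥ 4E`, `t ≤ ℓ/E`. -/
theorem decay_bound {p E ℓ t : ℕ} {c : ℝ} (hE : 0 < E) (hc0 : 0 ≤ c) (hc1 : c ≤ 1) (hp1 : (1 : ℝ) ≤ p)
    (hpc : (p : ℝ) * c ^ E ≤ 1 / 2) (hℓ : 4 * E ≤ ℓ) (ht : t ≤ ℓ / E) :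
    (p : ℝ) ^ t * c ^ ℓ ≤ 1 / 16 := by
  have hq4 : 4 ≤ ℓ / E := (Nat.le_div_iff_mul_le hE).mpr hℓ
  have hqE : E * (ℓ / E) ≤ ℓ := Nat.mul_div_le ℓ E
  have hp0 : (0 : ℝ) ≤ p := by linarith
  calc (p : ℝ) ^ t * c ^ ℓ ≤ (p : ℝ) ^ (ℓ / E) * c ^ (E * (ℓ / E)) :=
        mul_le_mul (pow_le_pow_right₀ hp1 ht) (pow_le_pow_of_le_one hc0 hc1 hqE) (by positivity)
          (by positivity)
    _ = ((p : ℝ) * c ^ E) ^ (ℓ / E) := by rw [mul_pow, pow_mul]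
    _ ≤ (1 / 2) ^ (ℓ / E) := pow_le_pow_left₀ (by positivity) hpc _
    _ ≤ (1 / 2) ^ 4 := pow_le_pow_of_le_one (by norm_num) (by norm_num) hq4
    _ = 1 / 16 := by norm_num

/-- **The cell law in window notation** (tree `TwoModuli.abs_three_mul_card_cell_sub_card_le`, Chattopadhyay–Wigderson
2009 Lemma 5): on every cell `{v : Φv = x}` of any sketch, `3·#{v ∈ cell : |v| ≡ b} − #cell ≤ 2(2cos(π/(3p)))^ℓ`. -/
theorem cell_law {p : ℕ} [NeZero p] (hp3 : p.Coprime 3) {ℓ d : ℕ} (Φ : Fin d → Fin ℓ → ZMod p)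
    (x : Fin d → ZMod p) (b : ℕ) :
    (3 : ℝ) * ((univ.filter fun v : Fin ℓ → Bool =>
        wt v % 3 = b % 3 ∧ (fun k => ∑ j, if v j then Φ k j else 0) = x).card : ℝ)
      - ((univ.filter fun v : Fin ℓ → Bool => (fun k => ∑ j, if v j then Φ k j else 0) = x).card : ℝ)
      ≤ 2 * (2 * Real.cos (Real.pi / (3 * p))) ^ ℓ := by
  have h := Literature.Computability.MetaComplexity.TwoModuli.abs_three_mul_card_cell_sub_card_le hp3 Φ x
    ((b : ℕ) : ZMod 3)
  rw [Fintype.card_fin] at h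
  have hset : (univ.filter fun v : Fin ℓ → Bool =>
        wt v % 3 = b % 3 ∧ (fun k => ∑ j, if v j then Φ k j else 0) = x)
      = univ.filter fun v : Fin ℓ → Bool =>
        ((univ.filter fun i => v i = true).card : ZMod 3) = ((b : ℕ) : ZMod 3) ∧
          (fun k => ∑ j, if v j then Φ k j else 0) = x := by
    refine Finset.filter_congr fun v _ => ?_
    rw [ZMod.natCast_eq_natCast_iff']
    rfl
  rw [hset]
  exact (abs_le.mp h).2

/-- **RUNG PROVED: `EquiRank p (ℓ ↦ ℓ/E)`** for every modulus `p ≥ 1` coprime to `3` (`p·cos(π/(3p))^E ≤ ½`, `ℓ ≥ 4E`):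
each level set `{G(Φv) = s}` is the disjoint union of the `≤ p^d` cells `{Φv = x}`, `G x = s`; summing the cell law,
`3·#{|v| ≡ b, G∘Φ = s} − #{G∘Φ = s} ≤ 2p^d(2cos(π/3p))^ℓ = 2·2^ℓ·(p^d cos^ℓ) ≤ 2^ℓ/8`. -/
theorem equiRank_of_coprime {p : ℕ} [NeZero p] (hp3 : p.Coprime 3) : EquiRankLin p := by
  obtain ⟨E, hE, hpc⟩ := exists_decay p (Nat.pos_of_ne_zero (NeZero.ne p))
  refine ⟨E, hE, 4 * E, fun ℓ hℓ d hd Φ G b s => ?_⟩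
  have hpi := Real.pi_pos
  have hp1 : (1 : ℝ) ≤ p := by exact_mod_cast Nat.pos_of_ne_zero (NeZero.ne p)
  have hxle : Real.pi / (3 * p) ≤ Real.pi / 2 := by
    apply div_le_div_of_nonneg_left hpi.le (by norm_num)
    linarith
  have hc0 : 0 ≤ Real.cos (Real.pi / (3 * p)) := by
    apply Real.cos_nonneg_of_neg_pi_div_two_le_of_le <;> linarith [show 0 < Real.pi / (3 * p) by positivity]
  have hc1 : Real.cos (Real.pi / (3 * p)) ≤ 1 := Real.cos_le_one _
  have hdec := decay_bound hE hc0 hc1 hp1 hpc hℓ hd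
  -- fibrewise decomposition of both counts over the cells of `Φ`
  have hA : ((univ.filter fun v : Fin ℓ → Bool =>
        wt v % 3 = b % 3 ∧ G (fun k => ∑ j, if v j then Φ k j else 0) = s).card : ℝ)
      = ∑ x : Fin d → ZMod p, (((univ.filter fun v : Fin ℓ → Bool =>
          wt v % 3 = b % 3 ∧ G (fun k => ∑ j, if v j then Φ k j else 0) = s).filter
            fun v => (fun k => ∑ j, if v j then Φ k j else 0) = x).card : ℝ) := by
    rw [Finset.card_eq_sum_card_fiberwise (f := fun v : Fin ℓ → Bool => (fun k => ∑ j, if v j then Φ k j else 0))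
      (t := univ) (fun v _ => Finset.mem_univ _)]
    push_cast
    rfl
  have hT : ((univ.filter fun v : Fin ℓ → Bool => G (fun k => ∑ j, if v j then Φ k j else 0) = s).card : ℝ)
      = ∑ x : Fin d → ZMod p, (((univ.filter fun v : Fin ℓ → Bool =>
          G (fun k => ∑ j, if v j then Φ k j else 0) = s).filter
            fun v => (fun k => ∑ j, if v j then Φ k j else 0) = x).card : ℝ) := by
    rw [Finset.card_eq_sum_card_fiberwise (f := fun v : Fin ℓ → Bool => (fun k => ∑ j, if v j then Φ k j else 0))
      (t := univ) (fun v _ => Finset.mem_univ _)]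
    push_cast
    rfl
  -- per-cell bound
  have hx : ∀ x : Fin d → ZMod p,
      (3 : ℝ) * (((univ.filter fun v : Fin ℓ → Bool =>
          wt v % 3 = b % 3 ∧ G (fun k => ∑ j, if v j then Φ k j else 0) = s).filter
            fun v => (fun k => ∑ j, if v j then Φ k j else 0) = x).card : ℝ)
        - (((univ.filter fun v : Fin ℓ → Bool => G (fun k => ∑ j, if v j then Φ k j else 0) = s).filter
            fun v => (fun k => ∑ j, if v j then Φ k j else 0) = x).card : ℝ)
        ≤ 2 * (2 * Real.cos (Real.pi / (3 * p))) ^ ℓ := by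
    intro x
    by_cases hGx : G x = s
    · have h1 : ((univ.filter fun v : Fin ℓ → Bool =>
            wt v % 3 = b % 3 ∧ G (fun k => ∑ j, if v j then Φ k j else 0) = s).filter
              fun v => (fun k => ∑ j, if v j then Φ k j else 0) = x)
          = univ.filter fun v : Fin ℓ → Bool =>
              wt v % 3 = b % 3 ∧ (fun k => ∑ j, if v j then Φ k j else 0) = x := by
        rw [Finset.filter_filter]
        refine Finset.filter_congr fun v _ => ?_
        constructor
        · rintro ⟨⟨hw, _⟩, hvx⟩
          exact ⟨hw, hvx⟩
        · rintro ⟨hw, hvx⟩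
          exact ⟨⟨hw, by rw [hvx]; exact hGx⟩, hvx⟩
      have h2 : ((univ.filter fun v : Fin ℓ → Bool => G (fun k => ∑ j, if v j then Φ k j else 0) = s).filter
              fun v => (fun k => ∑ j, if v j then Φ k j else 0) = x)
          = univ.filter fun v : Fin ℓ → Bool => (fun k => ∑ j, if v j then Φ k j else 0) = x := by
        rw [Finset.filter_filter]
        refine Finset.filter_congr fun v _ => ?_
        constructor
        · rintro ⟨_, hvx⟩
          exact hvx
        · intro hvx
          exact ⟨by rw [hvx]; exact hGx, hvx⟩
      rw [h1, h2]
      exact cell_law hp3 Φ x b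
    · have h1 : ((univ.filter fun v : Fin ℓ → Bool =>
            wt v % 3 = b % 3 ∧ G (fun k => ∑ j, if v j then Φ k j else 0) = s).filter
              fun v => (fun k => ∑ j, if v j then Φ k j else 0) = x) = ∅ := by
        rw [Finset.filter_filter]
        refine Finset.filter_eq_empty_iff.2 fun v _ => ?_
        rintro ⟨⟨_, hG⟩, hvx⟩
        rw [hvx] at hG
        exact hGx hG
      have h2 : ((univ.filter fun v : Fin ℓ → Bool => G (fun k => ∑ j, if v j then Φ k j else 0) = s).filter
              fun v => (fun k => ∑ j, if v j then Φ k j else 0) = x) = ∅ := by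
        rw [Finset.filter_filter]
        refine Finset.filter_eq_empty_iff.2 fun v _ => ?_
        rintro ⟨hG, hvx⟩
        rw [hvx] at hG
        exact hGx hG
      rw [h1, h2, Finset.card_empty]
      push_cast
      have : (0 : ℝ) ≤ (2 * Real.cos (Real.pi / (3 * p))) ^ ℓ := by positivity
      linarith
  -- sum over the `p^d` cells
  have hsum : (3 : ℝ) * ((univ.filter fun v : Fin ℓ → Bool =>
        wt v % 3 = b % 3 ∧ G (fun k => ∑ j, if v j then Φ k j else 0) = s).card : ℝ)
      - ((univ.filter fun v : Fin ℓ → Bool => G (fun k => ∑ j, if v j then Φ k j else 0) = s).card : ℝ)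
      ≤ (p : ℝ) ^ d * (2 * (2 * Real.cos (Real.pi / (3 * p))) ^ ℓ) := by
    rw [hA, hT, Finset.mul_sum, ← Finset.sum_sub_distrib]
    calc _ ≤ ∑ _x : Fin d → ZMod p, 2 * (2 * Real.cos (Real.pi / (3 * p))) ^ ℓ :=
          Finset.sum_le_sum fun x _ => hx x
      _ = (p : ℝ) ^ d * (2 * (2 * Real.cos (Real.pi / (3 * p))) ^ ℓ) := by
          rw [Finset.sum_const, Finset.card_univ, Fintype.card_fun, ZMod.card, Fintype.card_fin, nsmul_eq_mul]
          push_cast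
          ring
  have hpow : (p : ℝ) ^ d * (2 * (2 * Real.cos (Real.pi / (3 * p))) ^ ℓ)
      = 2 * 2 ^ ℓ * ((p : ℝ) ^ d * Real.cos (Real.pi / (3 * p)) ^ ℓ) := by
    rw [mul_pow]; ring
  rw [hpow] at hsum
  have hsmall : 2 * (2 : ℝ) ^ ℓ * ((p : ℝ) ^ d * Real.cos (Real.pi / (3 * p)) ^ ℓ) ≤ 2 * 2 ^ ℓ * (1 / 16) :=
    mul_le_mul_of_nonneg_left hdec (by positivity)
  have hfin : (24 : ℝ) * ((univ.filter fun v : Fin ℓ → Bool =>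
        wt v % 3 = b % 3 ∧ G (fun k => ∑ j, if v j then Φ k j else 0) = s).card : ℝ)
      ≤ 8 * ((univ.filter fun v : Fin ℓ → Bool => G (fun k => ∑ j, if v j then Φ k j else 0) = s).card : ℝ)
        + 2 ^ ℓ := by
    linarith
  exact_mod_cast hfin

/-- `p ≥ 5` prime is coprime to `3`: **the law at rank `ℓ/E` at every odd prime `p ≥ 5`**. -/
theorem equiRankLin_odd (p : ℕ) [Fact p.Prime] (hp : 5 ≤ p) : EquiRankLin p := by
  haveI : NeZero p := ⟨(Fact.out : p.Prime).ne_zero⟩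
  have h3 : p.Coprime 3 := (Nat.coprime_primes Fact.out Nat.prime_three).mpr (by omega)
  exact equiRank_of_coprime h3

end Rung

/-! ### §6 The ladder on the walk-game side and the frame: `closes` BY NAME, readbacks, comparison with g24 -/

section Frame
variable {p : ℕ} [Fact p.Prime]

/-- **PROVED for general tables**: `WindowRankSel p` for every modulus `p ≥ 1` coprime to `3` (θ = 19/24). -/
theorem windowRankSel_holds (p : ℕ) [NeZero p] (hp3 : p.Coprime 3) : WindowRankSel p := by
  obtain ⟨E, hE, ℓ₀, hW⟩ := window_bound_of_equiRankLin (equiRank_of_coprime hp3)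
  exact ⟨E, hE, 19 / 24, by norm_num, ℓ₀, fun L ℓ R hℓ c y hgap hrank => hW L ℓ R hℓ c y hgap hrank⟩

/-- The general-table piece implies the linear-test piece (drop the `LinSel` hypothesis). -/
theorem windowRankLinSel_of_windowRankSel (h : WindowRankSel p) : WindowRankLinSel p := by
  obtain ⟨E, hE, θ, hθ, ℓ₀, h⟩ := h
  exact ⟨E, hE, θ, hθ, ℓ₀, fun L ℓ R hℓ c y _ hgap hrank => h L ℓ R hℓ c y hgap hrank⟩

/-- **PIECE PROVED**: `WindowRankLinSel p` for every prime `p ≥ 5` (θ = 19/24; tables need not even be linear). -/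
theorem windowRankLinSel_holds (p : ℕ) [Fact p.Prime] (hp : 5 ≤ p) : WindowRankLinSel p := by
  haveI : NeZero p := ⟨(Fact.out : p.Prime).ne_zero⟩
  exact windowRankLinSel_of_windowRankSel
    (windowRankSel_holds p ((Nat.coprime_primes Fact.out Nat.prime_three).mpr (by omega)))

/-- **g24's proved piece is a corollary**: `WindowRankLinSel p ⟹ WindowFewLinSel p` (same `E`, same `θ`). -/
theorem windowFew_of_windowRank (h : WindowRankLinSel p) : WindowFewLinSel p := by
  obtain ⟨E, hE, θ, hθ, ℓ₀, h⟩ := h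
  exact ⟨E, hE, θ, hθ, ℓ₀, fun L ℓ R hℓ c y hy hgap hread =>
    h L ℓ R hℓ c y hy hgap (rankLE_of_readers_le y hy hread)⟩

/-- g24's light-readership piece `WindowFewLinSel p` for every prime `p ≥ 5`, recovered from the rank piece. -/
theorem windowFewLinSel_holds (p : ℕ) [Fact p.Prime] (hp : 5 ≤ p) : WindowFewLinSel p :=
  windowFew_of_windowRank (windowRankLinSel_holds p hp)

/-- **The new residual piece is smaller than g24's**: `WindowDenseLinSel p ⟹ WindowHighRankLinSel p`. -/
theorem windowHighRank_of_windowDense (h : WindowDenseLinSel p) : WindowHighRankLinSel p := by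
  intro E hE
  obtain ⟨θ, hθ, C, n₀, h⟩ := h E hE
  exact ⟨θ, hθ, C, n₀, fun L ℓ R hn hC c y hy hgap hnot =>
    h L ℓ R hn hC c y hy hgap (readers_gt_of_not_rankLE y hy hnot)⟩

/-- **The dial is exhaustive**: low-rank window ∨ high-rank window ∨ no window ⟹ rung R5 at `p`. -/
theorem r5_of_rank_pieces (hF : WindowRankLinSel p) (hD : WindowHighRankLinSel p) (hN : NoWindowLinSel p) :
    WalkHardFLinSel p := by
  obtain ⟨E, hE, θF, hθF, ℓ₀, hF⟩ := hF
  obtain ⟨θD, hθD, CD, nD, hD⟩ := hD E hE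
  obtain ⟨θN, hθN, hN⟩ := hN
  obtain ⟨nN, hN⟩ := hN (max CD ℓ₀)
  refine ⟨max θF (max θD θN), max_lt hθF (max_lt hθD hθN), max nD nN, fun n hn c y hy => ?_⟩
  have hpos : (0 : ℝ) < (2 : ℝ) ^ n := by positivity
  by_cases hw : ∃ a m : ℕ, a + m ≤ n ∧ max CD ℓ₀ * (Nat.log 2 n + 1) ≤ m ∧ CutFree y a m
  · obtain ⟨a, m, ham, hCm, hcf⟩ := hw
    obtain ⟨R', rfl⟩ : ∃ R', n = a + m + R' := ⟨n - (a + m), by omega⟩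
    have hlog : 1 ≤ Nat.log 2 (a + m + R') + 1 := Nat.le_add_left 1 _
    have hℓ₀ : ℓ₀ ≤ m := by
      calc ℓ₀ ≤ max CD ℓ₀ := le_max_right _ _
        _ = max CD ℓ₀ * 1 := (mul_one _).symm
        _ ≤ max CD ℓ₀ * (Nat.log 2 (a + m + R') + 1) := Nat.mul_le_mul_left _ hlog
        _ ≤ m := hCm
    by_cases hr : RankLE p y (m / E)
    · have h := hF a m R' hℓ₀ c y hy hcf hr
      calc ((univ.filter fun u : Fin (a + m + R') → Bool => ringWinU c y u = true).card : ℝ)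
          ≤ θF * (2 : ℝ) ^ (a + m + R') := h
        _ ≤ max θF (max θD θN) * (2 : ℝ) ^ (a + m + R') :=
          mul_le_mul_of_nonneg_right (le_max_left _ _) hpos.le
    · have hCD : CD * (Nat.log 2 (a + m + R') + 1) ≤ m :=
        le_trans (Nat.mul_le_mul_right _ (le_max_left CD ℓ₀)) hCm
      have h := hD a m R' (le_trans (le_max_left _ _) hn) hCD c y hy hcf hr
      calc ((univ.filter fun u : Fin (a + m + R') → Bool => ringWinU c y u = true).card : ℝ)
          ≤ θD * (2 : ℝ) ^ (a + m + R') := h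
        _ ≤ max θF (max θD θN) * (2 : ℝ) ^ (a + m + R') :=
          mul_le_mul_of_nonneg_right (le_trans (le_max_left _ _) (le_max_right _ _)) hpos.le
  · push Not at hw
    have h := hN n (le_trans (le_max_right _ _) hn) c y hy (fun a m ham hCm => hw a m ham hCm)
    calc ((univ.filter fun u : Fin n → Bool => ringWinU c y u = true).card : ℝ)
        ≤ θN * (2 : ℝ) ^ n := h
      _ ≤ max θF (max θD θN) * (2 : ℝ) ^ n :=
        mul_le_mul_of_nonneg_right (le_trans (le_max_right _ _) (le_max_right _ _)) hpos.le

/-- [g24] `T ⟹ R5Odd` (tree chain `JLinPeel.vpe_of_manyReaders`, `core_iff_vpe`, `walkHardFLinSel_of_core`). -/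
theorem r5Odd_of_target (hT : Theses.OddPrimeWalk.ManyReadersSqrtOdd) : R5Odd := fun p _ hp =>
  JLinPeel.walkHardFLinSel_of_core p (by omega) ((JLinPeel.core_iff_vpe p hp).mpr (JLinPeel.vpe_of_manyReaders hT p hp))

/-- The residual `R5LiftOdd` is implied by the target (trivially). -/
theorem r5LiftOdd_of_target (hT : Theses.OddPrimeWalk.ManyReadersSqrtOdd) : R5LiftOdd := fun _ => hT

/-- NECESSITY readbacks: each walk-game piece is implied by rung R5 (hence by T). -/
theorem windowRank_of_r5 (h : WalkHardFLinSel p) : WindowRankLinSel p := by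
  obtain ⟨θ, hθ, n₀, h⟩ := h
  exact ⟨1, Nat.one_pos, θ, hθ, n₀, fun L ℓ R hℓ c y hy _ _ => h (L + ℓ + R) (by omega) c y hy⟩

/-- NECESSITY readback: the high-rank window piece is implied by rung R5. -/
theorem windowHighRank_of_r5 (h : WalkHardFLinSel p) : WindowHighRankLinSel p := by
  obtain ⟨θ, hθ, n₀, h⟩ := h
  exact fun E _ => ⟨θ, hθ, 0, n₀, fun L ℓ R hn _ c y hy _ _ => h (L + ℓ + R) hn c y hy⟩

/-- NECESSITY readback: the dense-core piece is implied by rung R5. -/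
theorem noWindow_of_r5 (h : WalkHardFLinSel p) : NoWindowLinSel p := by
  obtain ⟨θ, hθ, n₀, h⟩ := h
  exact ⟨θ, hθ, fun _ => ⟨n₀, fun n hn c y hy _ => h n hn c y hy⟩⟩

/-- rung R5 at `p` ⟺ the three walk-game pieces at `p` -/
theorem r5_iff_rank_pieces :
    WalkHardFLinSel p ↔ (WindowRankLinSel p ∧ WindowHighRankLinSel p ∧ NoWindowLinSel p) :=
  ⟨fun h => ⟨windowRank_of_r5 h, windowHighRank_of_r5 h, noWindow_of_r5 h⟩,
   fun h => r5_of_rank_pieces h.1 h.2.1 h.2.2⟩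

/-- **`closes`** — the pieces give the target BY NAME: the low-rank grade is DISCHARGED (`windowRankLinSel_holds`), so
`(∀ p ≥ 5, WindowHighRankLinSel p) → (∀ p ≥ 5, NoWindowLinSel p) → R5LiftOdd → ManyReadersSqrtOdd`. -/
theorem closes (h₁ : ∀ (p : ℕ) [Fact p.Prime], 5 ≤ p → WindowHighRankLinSel p)
    (h₂ : ∀ (p : ℕ) [Fact p.Prime], 5 ≤ p → NoWindowLinSel p) (h₃ : R5LiftOdd) :
    Theses.OddPrimeWalk.ManyReadersSqrtOdd :=
  h₃ fun p _ hp => r5_of_rank_pieces (windowRankLinSel_holds p hp) (h₁ p hp) (h₂ p hp)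

/-- **`closes_all`** (all four pieces as hypotheses; used for the necessary cut `target_iff_pieces`). -/
theorem closes_all (h₀ : ∀ (p : ℕ) [Fact p.Prime], 5 ≤ p → WindowRankLinSel p)
    (h₁ : ∀ (p : ℕ) [Fact p.Prime], 5 ≤ p → WindowHighRankLinSel p)
    (h₂ : ∀ (p : ℕ) [Fact p.Prime], 5 ≤ p → NoWindowLinSel p) (h₃ : R5LiftOdd) :
    Theses.OddPrimeWalk.ManyReadersSqrtOdd :=
  h₃ fun p _ hp => r5_of_rank_pieces (h₀ p hp) (h₁ p hp) (h₂ p hp)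

/-- the necessary cut: `T ⟺ (pieces at every p ≥ 5) ∧ R5LiftOdd` -/
theorem target_iff_pieces : Theses.OddPrimeWalk.ManyReadersSqrtOdd ↔
    ((∀ (p : ℕ) [Fact p.Prime], 5 ≤ p → WindowRankLinSel p) ∧
     (∀ (p : ℕ) [Fact p.Prime], 5 ≤ p → WindowHighRankLinSel p) ∧
     (∀ (p : ℕ) [Fact p.Prime], 5 ≤ p → NoWindowLinSel p) ∧ R5LiftOdd) :=
  ⟨fun hT => ⟨fun p _ hp => windowRank_of_r5 (r5Odd_of_target hT p hp),
    fun p _ hp => windowHighRank_of_r5 (r5Odd_of_target hT p hp),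
    fun p _ hp => noWindow_of_r5 (r5Odd_of_target hT p hp), r5LiftOdd_of_target hT⟩,
   fun h => closes_all h.1 h.2.1 h.2.2.1 h.2.2.2⟩

/-- the necessary cut after §4: `T ⟺ HighRank∀p ∧ NoWindow∀p ∧ R5LiftOdd` -/
theorem target_iff_residual : Theses.OddPrimeWalk.ManyReadersSqrtOdd ↔
    ((∀ (p : ℕ) [Fact p.Prime], 5 ≤ p → WindowHighRankLinSel p) ∧
     (∀ (p : ℕ) [Fact p.Prime], 5 ≤ p → NoWindowLinSel p) ∧ R5LiftOdd) :=
  ⟨fun hT => ⟨(target_iff_pieces.mp hT).2.1, (target_iff_pieces.mp hT).2.2.1, (target_iff_pieces.mp hT).2.2.2⟩,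
   fun h => closes h.1 h.2.1 h.2.2⟩

/-- **The residual of rung R5 after the rank grade** (`p ≥ 5`): high-rank windows and the no-window core suffice. -/
theorem r5_residual (hp : 5 ≤ p) (hD : WindowHighRankLinSel p) (hN : NoWindowLinSel p) : WalkHardFLinSel p :=
  r5_of_rank_pieces (windowRankLinSel_holds p hp) hD hN

/-- **g25's residual lies inside g24's**: g24's residual pieces imply g25's. -/
theorem residual_shrinks (hD : WindowDenseLinSel p) (hN : NoWindowLinSel p) :
    WindowHighRankLinSel p ∧ NoWindowLinSel p :=
  ⟨windowHighRank_of_windowDense hD, hN⟩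

end Frame

end Summit.QuantumAdvantage.QuantumAdvantage.Theorems.RankDial

end
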